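import Literature.MathematicalPhysics.QuantumFieldTheory.Balaban1983to89.B15Prop1RealChartFamilySupport
import Literature.MathematicalPhysics.QuantumFieldTheory.Balaban1983to89.B15DeterminingSetsB

/-!
# `Balaban1983to89.B15Prop1RealChartFamilySupportB` — [Balaban1988Convergent] = «[III]», (2.2) p. 255, (2.11)–(2.12) p. 256, (2.16) p. 257; [Balaban1984PropagatorsII] = «[II]»,
# (2.3) p. 224 (the BOND-level determining datum); [Balaban1989LargeFieldI] = «[IV]», (1.74) p. 192, Prop. 1 p. 194 (last clause); [Balaban1989LargeFieldII] p. 357, (1.12) p. 359;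
# [Balaban1985Variational] = «[15]», (15) p. 280, Prop. 9 (190) p. 309:
# ★★ THE SUPPORT LETTER OF THE REAL CHART FAMILY (K′) OVER A BOND DETERMINING SET `𝔅 : BDetSet P` — print-datum ([II] (2.3)) edition of dag-n12-w5's
# `B15Prop1RealChartFamilySupport` (the three datum-bearing declarations N12's junction of record v14ᴸ uses: `apply_eq_of_isMinimizer_of_mem_extBonds`,
# `eventually_apply_eq_zero_of_isMinimizer_expChart_family`, `support_realChartFamily_atRecord`) — class (γ) of dag-n12-c's census-by-declaration v2 (bus [DAGN12C-G35], 2026-08-30)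

Honest framing: statement-level skeleton of published theorems with citation tags; proofs where landed; nothing here is a claim about the
Yang–Mills mass gap.  Cell `pub-ymgap`, seat `pub-ymgap-dag-n12-c` (g35; LANE OWNER N12 = [B15], strategy s1); count-neutral helper of K1⁹ (`stmt-QuantumFields-27364`);
N12 NOT discharged; finite 𝕋⁴ at fixed ε; nothing continuum ∕ OS ∕ mass-gap ∕ Clay.

WHY A SEPARATE EDITION (the (E1)(iii-b) re-attachment, director-ym №338–№358).  After the Stage-2 seam N12's Proposition-1 road is re-keyed from the tree's site-level determining
sets `𝐁 : DetSet P` (read through `bondsOf (𝐁 j)` = «a bond MEETS `Γ_j`») to print's [II] (2.3) BOND-level datum `𝔅 : BDetSet P` (`B15DeterminingSetsB.lamBondsSeq` ∕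
`B15Sect1Instances.lamDatumP`: «a bond LIES IN `Γ_j`», inward connectors dropped — ruling (α) №339).  The parent's §2∕§4 are generic in the determining set but typed `DetSet`; its §5 is
hard-wired to `𝐁_k(Z) = Bj ν.M₁ Z k`, whose scale-`0` member is `Γ₀ = Ω₁(Z)ᶜ` read as «`b₋ ∉ Ω₁(Z)` OR `b₊ ∉ Ω₁(Z)`» (`Bj_zero`).  Over a bond datum the pinned bonds are EXACTLY the
members of `𝔅 0` — under print's datum the bonds with BOTH endpoints off `Ω₁(Z)` (`B15Prop1GradientFromNearValueB.mem_lamDatumP_maxDomT_zero_of_not_mem₂`); a bond entering `Ω₁(Z)`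
from outside is a free variable of (2.12) and the family's coordinate on it need not vanish.  Accordingly §5 here is stated for a DISPLAYED support set `S : Set (PBond P 0)` with the
two letters `hS : ∀ b ∉ S, b ∈ 𝔅 0` (off `S` the bond is pinned) and `hfar : ∀ b ∉ S, ⟨blockIter k b₋, μ(b)⟩ ∉ bondsOf Λ^{(k)}` (off `S` the shadow misses the slice's bonds); the
parent's instance is `S := {b | b₋ ∈ Ω₁(Z)}` at `𝔅 := bondsDet (Bj ν.M₁ Z k)`, print's is `S := {b | b₋ ∈ Ω₁(Z) ∨ b₊ ∈ Ω₁(Z)}` at `𝔅 := lamDatumP … k (maxDomT ν.M₁ Z)`.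
RE-KEY NOTE for the junction's generator (dag-n12-d): `support_realChartFamily_atRecord` loses the binder `hk0 : 0 < k` and gains `(𝔅) (S) (hS)` before `hfar`; its two conclusions
read `b ∉ S` where the parent read `b.src ∉ maxDomT ν.M₁ Z 1`; the downstream window letters (`B15Prop1EndpointNearFlatLettersWindowB` …) carry the same `S`.

CONTENTS (theorems only; no `def`, no `instance`, no `sorry`; namespace `…B15Prop1RealChartFamilySupportB`, SAME declaration names as the parent; the parent's datum-free §1 and §3
are used as they stand).
* §2 `apply_eq_of_isMinimizer_of_mem_extBonds` — a (2.12) minimiser over `𝔅` equals the scale-`0` datum on every bond of `𝔅 0` (the constraint at `j = 0`, `M⁰ = id`).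
* §4 ★★ `eventually_apply_eq_zero_of_isMinimizer_expChart_family` (over `𝔅`; proof verbatim), (private) `fderiv_apply_eq_zero_of_eventually_apply_eq_zero` (bookkeeping, copied).
* §5 ★★★ `support_realChartFamily_atRecord` — at the endpoint's averaging ∕ class VERBATIM, over a displayed `𝔅 : BDetSet (F.P Kt)` and support set `S` with the letters `hS`, `hfar`.
HONEST SCOPE: finite-dimensional calculus and (2.2)∕(2.11)∕(2.16) bookkeeping; the family (K′) and its minimality letter are HYPOTHESES; nothing of Bałaban's estimates is asserted;
N12 NOT discharged; K1⁹ NOT closed.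
-/

noncomputable section

open Set Metric Filter
open scoped Topology Matrix.Norms.L2Operator

namespace Literature.MathematicalPhysics.QuantumFieldTheory.Balaban1983to89.B15Prop1RealChartFamilySupportB

open B15Prop1SliceCoordinates (GaugeSlice ιA freeBonds mem_freeBonds ιA_apply_of_not_mem)
open B15Prop1ChartCalculusSU2 (E3)
open B15Prop1ChartSU2 (su2Chart)
open T4CubeChartGnomonic (SU2)
open T4Continuum B15DeterminingSets B15DeterminingSetsB GaugeField
open T4AdjointCovarianceUnitary (lieSU expSU coe_expSU)
open Node00 (expChart expChart_zero SU)
open B14.Eq213DetSet B14.Eq216Concrete B14.Eq22Determines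
open B16Sect1Backgrounds (expMul ExpChart)
open B15Prop1RealChartFamilySupport (eventually_forall_apply_eq_zero_of_expChart_apply_eq qsstarGIter0_expMul_ιA_of_not_mem_freeBonds)
open Literature.MathematicalPhysics.QuantumFieldTheory.BalabanImbrieJaffe1984to88.BIJ85Eq453GaugeField (qsstarGIter0)

/-! ## §2  The `𝔅 0`-pin of a (2.12) minimiser over a bond determining set -/

section Pin

variable {P : Params} {G : Type*} [GaugeGroup G]

/-- **THE `𝔅 0`-PIN**: a (2.12) minimal configuration `U` for the datum `V` on the BOND determining set `𝔅` EQUALS the scale-`0` datum `V₀` on every bond of `𝔅 0` — the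
constraint `M_𝔅(U) = V` at `j = 0` with `M⁰ = id` ((2.11): «M_𝐁(U) = M^j(U) on Γ_j, j = 0, 1, …, k»; print's [II] (2.3): the bonds LYING IN `Γ₀`).  Any group, any averaging,
any class. [cite: Balaban1988Convergent, (2.2) p.255, (2.11)–(2.12) p.256; Balaban1984PropagatorsII, (2.3) p.224] -/
theorem apply_eq_of_isMinimizer_of_mem_extBonds (av : ∀ j, Averaging P j G) (reg : Set (GaugeField P 0 G)) (𝔅 : BDetSet P)
    (V : MSField P G) {U : GaugeField P 0 G} (hU : IsMinimizerB av reg 𝔅 V U) {b : PBond P 0} (hb : b ∈ 𝔅 0) : U b = V 0 b :=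
  hU.2.1 0 b hb

end Pin

/-! ## §4  The support letter along any family of (2.12) minimisers in the exponential chart, over `𝔅` -/

section Support

variable {P : Params} {k : ℕ} [DecidableEq (PBond P k)] {N : ℕ} [NeZero N]
  {𝔤 : Type*} [NormedAddCommGroup 𝔤] [InnerProductSpace ℝ 𝔤] (ch : ExpChart (SU N) 𝔤)

/-- ★★ **THE CHART COORDINATES OF A FAMILY OF (2.12) MINIMISERS VANISH ON THE PINNED BONDS** (bond-datum edition).  Let `Y ↦ expChart U₀ (X_f Y)` be, for `Y` near `0`, a (2.12)
minimal configuration for the datum `M˙(Q_k^{s*}(exp(i·ιA (Yv Y))·W))` on a bond determining set `𝔅` (any averaging family `av`, any class `reg`, any parameter space `G'`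
mapped into the slice by `Yv`), with `X_f 0 = 0` and `X_f` continuous at `0`.  Then for all `Y` near `0`: on every bond `b ∈ 𝔅 0` whose coarse shadow `⟨blockIter k b₋, μ(b)⟩` is
not a free bond of the slice, `X_f Y (b) = 0` — the configuration is pinned there to a `Y`-independent datum (§2, parent §3), so `U₀(b)·exp(X_f Y (b)) = U₀(b)`, and `exp` is
injective near `0` (parent §1).
[cite: Balaban1988Convergent, (2.2) p.255, (2.11)–(2.12) p.256, (2.16) p.257; Balaban1985Variational, (15) p.280, Prop. 9 (190) p.309; Balaban1989LargeFieldII, p.359; Balaban1984PropagatorsII, (2.3) p.224] -/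
theorem eventually_apply_eq_zero_of_isMinimizer_expChart_family (hk : k ≤ P.m + P.K) (S : Set (Site P k)) (T : Finset (PBond P k))
    (av : ∀ j, Averaging P j (SU N)) (reg : Set (GaugeField P 0 (SU N))) (𝔅 : BDetSet P) (W : GaugeField P k (SU N))
    (U₀ : GaugeField P 0 (SU N)) {G' : Type*} [TopologicalSpace G'] [Zero G'] (Yv : G' → GaugeSlice S T 𝔤)
    (Xf : G' → PBond P 0 → lieSU (Fin N)) (hX₀ : Xf 0 = 0) (hXc : ContinuousAt Xf 0)
    (hmin : ∀ᶠ Y in 𝓝 (0 : G'), IsMinimizerB av reg 𝔅 (avgFamily av (qsstarGIter0 k (expMul ch (ιA S T (Yv Y)) W))) (expChart U₀ (Xf Y))) :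
    ∀ᶠ Y in 𝓝 (0 : G'), ∀ b : PBond P 0, b ∈ 𝔅 0 → (⟨blockIter k b.src, b.dir⟩ : PBond P k) ∉ freeBonds S T → Xf Y b = 0 := by
  -- the base point: `U₀` itself is pinned to `Q_k^{s*}W` on the bonds of `𝔅 0`
  have hmin0 : IsMinimizerB av reg 𝔅 (avgFamily av (qsstarGIter0 k (expMul ch (ιA S T (Yv 0)) W))) (expChart U₀ (Xf 0)) := hmin.self_of_nhds
  rw [hX₀, expChart_zero] at hmin0
  -- `X_f Y → 0`, so the parent's §1 applies along the family
  have htend : Tendsto Xf (𝓝 0) (𝓝 0) := by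
    have h := hXc
    rw [ContinuousAt, hX₀] at h
    exact h
  filter_upwards [hmin, htend.eventually (eventually_forall_apply_eq_zero_of_expChart_apply_eq U₀)] with Y hY hinj b hb hsh
  apply hinj b
  -- both configurations equal the (common) datum at `b`
  have h1 : expChart U₀ (Xf Y) b = qsstarGIter0 k (expMul ch (ιA S T (Yv Y)) W) b :=
    apply_eq_of_isMinimizer_of_mem_extBonds av reg 𝔅 _ hY hb
  have h0 : U₀ b = qsstarGIter0 k (expMul ch (ιA S T (Yv 0)) W) b :=
    apply_eq_of_isMinimizer_of_mem_extBonds av reg 𝔅 _ hmin0 hb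
  rw [h1, h0, qsstarGIter0_expMul_ιA_of_not_mem_freeBonds ch hk S T (Yv Y) W hsh,
    qsstarGIter0_expMul_ιA_of_not_mem_freeBonds ch hk S T (Yv 0) W hsh]

/-- **BOOKKEEPING: a coordinate that vanishes near `0` has vanishing velocity** — for any map `X_f` into bond fields with `X_f Y (b) = 0` for `Y` near `0`, the `b`-component of
`fderiv ℝ X_f 0 X` is `0` for every direction `X` (if `X_f` is differentiable at `0` by the chain rule through the evaluation map, otherwise `fderiv = 0`); private plumbing
(copied from the parent, where it is private). [folklore] -/
private theorem fderiv_apply_eq_zero_of_eventually_apply_eq_zero {G' : Type*} [NormedAddCommGroup G'] [NormedSpace ℝ G']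
    {ι E : Type*} [Fintype ι] [NormedAddCommGroup E] [NormedSpace ℝ E]
    (Xf : G' → ι → E) {b : ι} (h : ∀ᶠ Y in 𝓝 (0 : G'), Xf Y b = 0) (X : G') : fderiv ℝ Xf 0 X b = 0 := by
  by_cases hd : DifferentiableAt ℝ Xf 0
  · have hcomp : fderiv ℝ (fun Y => Xf Y b) 0 = (ContinuousLinearMap.proj (R := ℝ) b).comp (fderiv ℝ Xf 0) := by
      have h1 : HasFDerivAt (fun Y => Xf Y b) ((ContinuousLinearMap.proj (R := ℝ) b).comp (fderiv ℝ Xf 0)) 0 :=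
        (ContinuousLinearMap.proj (R := ℝ) (φ := fun _ : ι => E) b).hasFDerivAt.comp 0 hd.hasFDerivAt
      exact h1.fderiv
    have hzero : fderiv ℝ (fun Y => Xf Y b) 0 = 0 := by
      have hc : (fun Y => Xf Y b) =ᶠ[𝓝 0] fun _ => (0 : E) := h
      rw [hc.fderiv_eq, fderiv_const_apply]
    have h2 := congrArg (fun L : G' →L[ℝ] E => L X) (hcomp.symm.trans hzero)
    simpa using h2
  · rw [fderiv_zero_of_not_differentiableAt hd]
    rfl

end Support

/-! ## §5  At the endpoint's objects: the support letter of (K′) over a bond datum and a displayed support set -/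

section AtRecord

variable {F : T4Family}

/-- ★★★ **THE SUPPORT LETTER OF THE REAL CHART FAMILY (K′) AT THE ENDPOINT'S OBJECTS — BOND-DATUM EDITION.**  At one Prop-1 instance (averaging `Node00.avOfRecord F 2 Kt`, class
`Node00.regMSCoPOfRecord F 2 ν Kt k (maxDomT ν.M₁ Z)`, a BOND determining set `𝔅 : BDetSet (F.P Kt)` — print's [II] (2.3) datum `lamDatumP … k (maxDomT ν.M₁ Z)` at the junction —,
slice `GaugeSlice (pts k Λ) T E3`, base field `ext Ṽ_k`, `k ≤ m + K`) and for a displayed support set `S` of fine bonds with the two letters `hS` (every bond off `S` lies in `𝔅 0`,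
i.e. is pinned by (2.12) at scale `0`) and `hfar` (every bond off `S` has its coarse shadow off the bonds of `Λ^{(k)}`): the (K′) package's conclusions `X_f 0 = 0`, `X_f` continuous
at `0` and the minimality letter `hmin` give (i) for all `Y` near `0`, `X_f Y (b) = 0` for every `b ∉ S`, and (ii) for every slice vector `X`, `(fderiv ℝ X_f 0 X) b = 0` for every
`b ∉ S` — the velocity `w = X_f′(0)X` of the family is supported on `S`.  (Parent: `S = {b | b₋ ∈ Ω₁(Z)}` at `bondsDet (Bj ν.M₁ Z k)`; print's datum: `S = {b | b₋ ∈ Ω₁(Z) ∨ b₊ ∈ Ω₁(Z)}`,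
`hS` = `B15Prop1GradientFromNearValueB.mem_lamDatumP_maxDomT_zero_of_not_mem₂`.)  The shape a localised (δ₁) letter consumes; nothing of Bałaban's is asserted.
[cite: Balaban1989LargeFieldI, (1.74) p.192, Prop. 1 p.194 (last clause); Balaban1989LargeFieldII, p.357, (1.12) p.359; Balaban1988Convergent, (2.2) p.255, (2.11)–(2.13) pp.256–257, (2.16) p.257; Balaban1985Variational, (15) p.280, Prop. 9 (190) p.309; Balaban1984PropagatorsII, (2.3) p.224] -/
theorem support_realChartFamily_atRecord (ν : Node00.Stage7Numerics) (Kt : ℕ) {k : ℕ} (hk : k ≤ (F.P Kt).m + (F.P Kt).K)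
    (𝔅 : BDetSet (F.P Kt)) (Z Λ : Set (Site (F.P Kt) 0)) (T : Finset (PBond (F.P Kt) k))
    (ext : GaugeField (F.P Kt) k SU2 → GaugeField (F.P Kt) k SU2) (Vk : GaugeField (F.P Kt) k SU2)
    (S : Set (PBond (F.P Kt) 0)) (hS : ∀ b ∉ S, b ∈ 𝔅 0)
    (hfar : ∀ b ∉ S, (⟨blockIter k b.src, b.dir⟩ : PBond (F.P Kt) k) ∉ bondsOf (pts k Λ))
    (U₀ : GaugeField (F.P Kt) 0 SU2) (Xf : GaugeSlice (pts k Λ) T E3 → PBond (F.P Kt) 0 → lieSU (Fin 2)) (hX₀ : Xf 0 = 0) (hXc : ContinuousAt Xf 0)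
    (hmin : ∀ᶠ Y in 𝓝 (0 : GaugeSlice (pts k Λ) T E3),
      IsMinimizerB (Node00.avOfRecord F 2 Kt) (Node00.regMSCoPOfRecord F 2 ν Kt k (maxDomT ν.M₁ Z)) 𝔅
        (avgFamily (Node00.avOfRecord F 2 Kt) (qsstarGIter0 k (expMul su2Chart (ιA (pts k Λ) T Y) (ext Vk)))) (expChart U₀ (Xf Y))) :
    (∀ᶠ Y in 𝓝 (0 : GaugeSlice (pts k Λ) T E3), ∀ b ∉ S, Xf Y b = 0) ∧
      ∀ (X : GaugeSlice (pts k Λ) T E3), ∀ b ∉ S, fderiv ℝ Xf 0 X b = 0 := by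
  have hsh : ∀ b ∉ S, (⟨blockIter k b.src, b.dir⟩ : PBond (F.P Kt) k) ∉ freeBonds (pts k Λ) T :=
    fun b hb h => hfar b hb (mem_freeBonds.1 h).1
  have h := eventually_apply_eq_zero_of_isMinimizer_expChart_family su2Chart hk (pts k Λ) T (Node00.avOfRecord F 2 Kt)
    (Node00.regMSCoPOfRecord F 2 ν Kt k (maxDomT ν.M₁ Z)) 𝔅 (ext Vk) U₀ id Xf hX₀ hXc hmin
  refine ⟨h.mono fun Y hY b hb => hY b (hS b hb) (hsh b hb), fun X b hb => ?_⟩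
  exact fderiv_apply_eq_zero_of_eventually_apply_eq_zero Xf (h.mono fun Y hY => hY b (hS b hb) (hsh b hb)) X

end AtRecord

end Literature.MathematicalPhysics.QuantumFieldTheory.Balaban1983to89.B15Prop1RealChartFamilySupportB

end
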